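import Literature.Topology.FourManifolds.BallGluingSeam
import HarnessLib

/-!
# The fold-out map of a gluing of two discs is a bicollar of the seam

Trunk T-4MAN (`Literature/Topology/FourManifolds`). Fourth of the files discharging, for two
closed discs, the tree's named fact `Literature.Topology.FourManifolds.nonempty_diffeomorph_of_isBoundaryGluing` (`Gluing.lean`;
Hirsch (1976), Ch. 8, Thm. 2.1), after `CollarUniquenessBall.lean`, `BallGluingCharts.lean` and
`BallGluingSeam.lean`.

For gluing data `G : BallGluingData n φ P` of `P = 𝔻ⁿ⁺¹ ∪_φ 𝔻ⁿ⁺¹` (`P` Hausdorff) the fold-out map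
`G.fold : P → ℝⁿ⁺¹` of `BallGluingSeam.lean` is `C^∞` near the seam, with invertible derivative at
every seam point, and injective on the seam (`fold (jA z) = z`). Here we globalise:

* injectivity of `G.fold` on a neighbourhood of the seam (`G.exists_injOn_fold`) from Mathlib's
  `Set.InjOn.exists_isOpen_superset` (a map injective on a compact set, continuous there with
  Hausdorff target and injective near each of its points is injective on an open superset);
* `G.foldRadius = ε > 0` and the open neighbourhood `G.foldNbhd` of the seam which `G.fold` maps
  bijectively onto the **spherical shell** `Literature.biShell ε = {x | 1 - ε < ‖x‖ < 1 + ε}`, with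
  `C^∞` inverse `G.foldInv` (`G.contMDiffOn_foldInv`) — i.e. `fold` restricted to `foldNbhd` is
  a diffeomorphism onto the shell, a **bicollar of the seam** in which the seam is the unit
  sphere, the first disc is `{‖x‖ ≤ 1}` and the second disc is `{1 ≤ ‖x‖}`
  (`G.norm_fold_le_one_iff`, `G.one_le_norm_fold_iff`).

This is, for the seam of a gluing of two discs, the bicollaring theorem (Hirsch (1976), Ch. 4
§6; Munkres (1966), §5) obtained without flows. `BallGluingUniqueness.lean` turns the two
restrictions of `foldInv` into inner collars of `∂𝔻ⁿ⁺¹` in the two discs and concludes with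
`CollarUniquenessBall.lean`.

## References

* M. W. Hirsch, *Differential Topology*, GTM 33, Springer (1976), Ch. 4 §6, Ch. 8 §2.
* J. R. Munkres, *Elementary Differential Topology*, Ann. of Math. Studies 54 (1966), §5–6.
-/

open scoped Manifold ContDiff Topology
open Set Function Metric Filter

noncomputable section

namespace Literature.Topology.FourManifolds

attribute [local instance] fact_finrank_euclideanSpace_succ

/-! ### Spherical shells -/

section Shell

variable {E : Type*} [NormedAddCommGroup E]

/-- The **two-sided open spherical shell** `{x | 1 - ε < ‖x‖ < 1 + ε}`. [folklore] -/
def biShell (ε : ℝ) : Set E := {x | 1 - ε < ‖x‖ ∧ ‖x‖ < 1 + ε}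

variable {ε : ℝ} {x : E}

/-- Membership in the shell. [folklore] -/
@[simp] theorem mem_biShell_iff : x ∈ (biShell ε : Set E) ↔ 1 - ε < ‖x‖ ∧ ‖x‖ < 1 + ε := Iff.rfl

/-- The shell is open. [folklore] -/
theorem isOpen_biShell (ε : ℝ) : IsOpen (biShell ε : Set E) :=
  (isOpen_lt continuous_const continuous_norm).inter (isOpen_lt continuous_norm continuous_const)

/-- Shells are monotone. [folklore] -/
theorem biShell_mono {ε ε' : ℝ} (h : ε' ≤ ε) : (biShell ε' : Set E) ⊆ biShell ε := fun _ hx =>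
  ⟨by linarith [hx.1], by linarith [hx.2]⟩

/-- Unit vectors lie in every shell of positive width. [folklore] -/
theorem mem_biShell_of_norm_eq_one (hε : 0 < ε) (hx : ‖x‖ = 1) : x ∈ (biShell ε : Set E) :=
  ⟨by linarith, by linarith⟩

/-- Points of a shell of width `≤ 1` are nonzero. [folklore] -/
theorem ne_zero_of_mem_biShell (hε : ε ≤ 1) (hx : x ∈ (biShell ε : Set E)) : x ≠ 0 := by
  rintro rfl
  have := hx.1
  rw [norm_zero] at this
  linarith

variable [NormedSpace ℝ E]

/-- A shell lies in the thickening of the unit sphere of the same width. [folklore] -/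
theorem biShell_subset_thickening (hε : ε ≤ 1) :
    (biShell ε : Set E) ⊆ thickening ε (sphere (0 : E) 1) := by
  intro x hx
  have hx0 : x ≠ 0 := ne_zero_of_mem_biShell hε hx
  have hn : ‖x‖ ≠ 0 := norm_ne_zero_iff.2 hx0
  rw [mem_thickening_iff]
  refine ⟨‖x‖⁻¹ • x, by simp [norm_smul, hn], ?_⟩
  rw [dist_eq_norm]
  have : x - ‖x‖⁻¹ • x = (1 - ‖x‖⁻¹) • x := by rw [sub_smul, one_smul]
  rw [this, norm_smul, Real.norm_eq_abs]
  have h1 : |1 - ‖x‖⁻¹| * ‖x‖ = |‖x‖ - 1| := by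
    rw [← abs_of_pos (norm_pos_iff.2 hx0), ← abs_mul, abs_of_pos (norm_pos_iff.2 hx0)]
    congr 1
    field_simp
  rw [h1, abs_lt]
  constructor <;> linarith [hx.1, hx.2]

end Shell

/-! ### Notation -/

/-- Local notation for the model space `ℝⁿ`. -/
local notation "𝔼 " n:arg => EuclideanSpace ℝ (Fin n)
/-- Local notation for the unit sphere `𝕊ⁿ ⊆ ℝⁿ⁺¹`. -/
local notation "𝕊 " n:arg => (Metric.sphere (0 : EuclideanSpace ℝ (Fin (n + 1))) 1)
/-- Local notation for the closed unit ball `𝔻ⁿ ⊆ ℝⁿ`. -/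
local notation "𝔻 " n:arg => (Metric.closedBall (0 : EuclideanSpace ℝ (Fin n)) 1)

section FoldOut

variable {n : ℕ} {φ : (𝕊 n) ≃ₘ⟮𝓡 n, 𝓡 n⟯ (𝕊 n)} {P : Type*} [TopologicalSpace P]
  [ChartedSpace (𝔼 (n + 1)) P] [IsManifold (𝓡 (n + 1)) ∞ P] [T2Space P]

namespace BallGluingData

variable (G : BallGluingData n φ P)

/-! ### Local inverses in each adapted chart -/

/-- The good neighbourhood of the centre in the adapted chart at `w` (from
`exists_foldChart_nhds`: open, in the target ball, on it `foldChart w` is `C^∞` with invertible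
derivative). [folklore] -/
def foldGood (w : 𝕊 n) : Set (𝔼 (n + 1)) := (G.exists_foldChart_nhds w).choose

/-- `foldGood w` is open. [folklore] -/
theorem isOpen_foldGood (w : 𝕊 n) : IsOpen (G.foldGood w) :=
  (G.exists_foldChart_nhds w).choose_spec.1

/-- The centre lies in `foldGood w`. [folklore] -/
theorem center_mem_foldGood (w : 𝕊 n) : (G.seamChart w).center ∈ G.foldGood w :=
  (G.exists_foldChart_nhds w).choose_spec.2.1

/-- `foldGood w` lies in the target ball. [folklore] -/
theorem foldGood_subset_ball (w : 𝕊 n) :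
    G.foldGood w ⊆ ball (G.seamChart w).center (G.seamChart w).radius :=
  (G.exists_foldChart_nhds w).choose_spec.2.2.1

/-- `foldChart w` is `C^∞` on `foldGood w`. [folklore] -/
theorem contDiffOn_foldChart_foldGood (w : 𝕊 n) : ContDiffOn ℝ ∞ (G.foldChart w) (G.foldGood w) :=
  (G.exists_foldChart_nhds w).choose_spec.2.2.2.1

/-- `foldChart w` has invertible derivative on `foldGood w`. [folklore] -/
theorem exists_hasFDerivAt_foldChart (w : 𝕊 n) {u : 𝔼 (n + 1)} (hu : u ∈ G.foldGood w) :
    ∃ e : (𝔼 (n + 1)) ≃L[ℝ] 𝔼 (n + 1),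
      HasFDerivAt (G.foldChart w) (e : (𝔼 (n + 1)) →L[ℝ] 𝔼 (n + 1)) u :=
  (G.exists_foldChart_nhds w).choose_spec.2.2.2.2 u hu

/-- `foldChart w` is `C^∞` at points of `foldGood w`. [folklore] -/
theorem contDiffAt_foldChart_of_mem (w : 𝕊 n) {u : 𝔼 (n + 1)} (hu : u ∈ G.foldGood w) :
    ContDiffAt ℝ ∞ (G.foldChart w) u :=
  (G.contDiffOn_foldChart_foldGood w).contDiffAt ((G.isOpen_foldGood w).mem_nhds hu)

/-- **The local inverse of the fold-out map in the chart at `w`** (inverse function theorem),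
restricted to the good neighbourhood. [folklore] -/
def foldLocal (w : 𝕊 n) : OpenPartialHomeomorph (𝔼 (n + 1)) (𝔼 (n + 1)) :=
  ((G.contDiffAt_foldChart_center w).toOpenPartialHomeomorph (G.foldChart w)
    (G.hasFDerivAt_foldChart w) (by simp)).restrOpen (G.foldGood w) (G.isOpen_foldGood w)

/-- `foldLocal w` is `foldChart w` as a function. [folklore] -/
@[simp] theorem coe_foldLocal (w : 𝕊 n) :
    (G.foldLocal w : (𝔼 (n + 1)) → 𝔼 (n + 1)) = G.foldChart w :=
  rfl

/-- The source of `foldLocal w` lies in the good neighbourhood. [folklore] -/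
theorem foldLocal_source_subset (w : 𝕊 n) : (G.foldLocal w).source ⊆ G.foldGood w := by
  rw [foldLocal, OpenPartialHomeomorph.restrOpen_source]
  exact inter_subset_right

/-- The centre lies in the source of `foldLocal w`. [folklore] -/
theorem center_mem_foldLocal_source (w : 𝕊 n) :
    (G.seamChart w).center ∈ (G.foldLocal w).source := by
  rw [foldLocal, OpenPartialHomeomorph.restrOpen_source]
  exact ⟨ContDiffAt.mem_toOpenPartialHomeomorph_source _ _ (by simp), G.center_mem_foldGood w⟩

/-- **The inverse of `foldLocal w` is `C^∞` on its target.** [folklore] -/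
theorem contDiffAt_foldLocal_symm (w : 𝕊 n) {x : 𝔼 (n + 1)} (hx : x ∈ (G.foldLocal w).target) :
    ContDiffAt ℝ ∞ (G.foldLocal w).symm x := by
  have hs : (G.foldLocal w).symm x ∈ G.foldGood w :=
    G.foldLocal_source_subset w ((G.foldLocal w).map_target hx)
  obtain ⟨e, he⟩ := G.exists_hasFDerivAt_foldChart w hs
  exact (G.foldLocal w).contDiffAt_symm hx he (G.contDiffAt_foldChart_of_mem w hs)

/-- The inverse of `foldLocal w` is `C^∞` on its (open) target. [folklore] -/
theorem contDiffOn_foldLocal_symm (w : 𝕊 n) :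
    ContDiffOn ℝ ∞ (G.foldLocal w).symm (G.foldLocal w).target := fun _ hx =>
  (G.contDiffAt_foldLocal_symm w hx).contDiffWithinAt

/-- **The good open set of `P` at `w`**: the part of the source of the adapted chart over the
source of `foldLocal w`. [folklore] -/
def foldPatch (w : 𝕊 n) : Set P :=
  (G.seamChart w).chart.source ∩ (G.seamChart w).chart ⁻¹' (G.foldLocal w).source

/-- `foldPatch w` is open. [folklore] -/
theorem isOpen_foldPatch (w : 𝕊 n) : IsOpen (G.foldPatch w) :=
  (G.seamChart w).chart.isOpen_inter_preimage (G.foldLocal w).open_source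

/-- The seam point `jA w` lies in `foldPatch w`. [folklore] -/
theorem jA_mem_foldPatch (w : 𝕊 n) : G.jA (sphereToBall n w) ∈ G.foldPatch w :=
  ⟨(G.seamChart w).mem_source, by
    rw [mem_preimage, (G.seamChart w).apply_seamPoint]; exact G.center_mem_foldLocal_source w⟩

/-- On `foldPatch w` the fold-out map factors as `foldLocal w ∘ chart_w`. [folklore] -/
theorem fold_eq_foldLocal {w : 𝕊 n} {p : P} (hp : p ∈ G.foldPatch w) :
    G.fold p = G.foldLocal w ((G.seamChart w).chart p) := by
  rw [coe_foldLocal, foldChart, comp_apply, (G.seamChart w).chart.left_inv hp.1]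

/-- The fold-out map is injective on `foldPatch w`. [folklore] -/
theorem injOn_fold_foldPatch (w : 𝕊 n) : InjOn G.fold (G.foldPatch w) := by
  intro p hp q hq h
  rw [G.fold_eq_foldLocal hp, G.fold_eq_foldLocal hq] at h
  have := (G.foldLocal w).injOn hp.2 hq.2 h
  exact (G.seamChart w).chart.injOn hp.1 hq.1 this

/-- The fold-out map is `C^∞` on `foldPatch w`. [folklore] -/
theorem contMDiffOn_fold_foldPatch (w : 𝕊 n) :
    ContMDiffOn (𝓡 (n + 1)) 𝓘(ℝ, 𝔼 (n + 1)) ∞ G.fold (G.foldPatch w) := by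
  have h1 : ContMDiffOn 𝓘(ℝ, 𝔼 (n + 1)) 𝓘(ℝ, 𝔼 (n + 1)) ∞ (G.foldChart w) (G.foldGood w) :=
    contMDiffOn_iff_contDiffOn.2 (G.contDiffOn_foldChart_foldGood w)
  have h2 := h1.comp ((G.seamChart w).contMDiffOn_chart.mono (inter_subset_left (t :=
    (G.seamChart w).chart ⁻¹' (G.foldLocal w).source)))
    fun p hp => G.foldLocal_source_subset w hp.2
  refine h2.congr fun p hp => ?_
  exact G.fold_eq_foldLocal hp

/-- The image of an open subset of `foldPatch w` under the fold-out map is open. [folklore] -/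
theorem isOpen_image_fold {w : 𝕊 n} {U : Set P} (hU : IsOpen U) (hUw : U ⊆ G.foldPatch w) :
    IsOpen (G.fold '' U) := by
  have h1 : G.fold '' U = G.foldLocal w '' ((G.seamChart w).chart '' U) := by
    rw [image_image]
    exact image_congr fun p hp => G.fold_eq_foldLocal (hUw hp)
  rw [h1]
  apply (G.foldLocal w).isOpen_image_of_subset_source
  · exact (G.seamChart w).chart.isOpen_image_of_subset_source hU fun p hp => (hUw hp).1
  · rintro _ ⟨p, hp, rfl⟩
    exact (hUw hp).2

/-- The local inverse of the fold-out map over `foldPatch w`: `chart_w⁻¹ ∘ (foldLocal w)⁻¹`.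
[folklore] -/
def foldInvLoc (w : 𝕊 n) : (𝔼 (n + 1)) → P := (G.seamChart w).chart.symm ∘ (G.foldLocal w).symm

/-- `foldInvLoc w` inverts `fold` on `foldPatch w`. [folklore] -/
theorem foldInvLoc_fold {w : 𝕊 n} {p : P} (hp : p ∈ G.foldPatch w) :
    G.foldInvLoc w (G.fold p) = p := by
  rw [foldInvLoc, comp_apply, G.fold_eq_foldLocal hp, (G.foldLocal w).left_inv hp.2,
    (G.seamChart w).chart.left_inv hp.1]

/-- `foldInvLoc w` is `C^∞` on the image of `foldPatch w`. [folklore] -/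
theorem contMDiffAt_foldInvLoc {w : 𝕊 n} {p : P} (hp : p ∈ G.foldPatch w) :
    ContMDiffAt 𝓘(ℝ, 𝔼 (n + 1)) (𝓡 (n + 1)) ∞ (G.foldInvLoc w) (G.fold p) := by
  have hx : G.fold p ∈ (G.foldLocal w).target := by
    rw [G.fold_eq_foldLocal hp]; exact (G.foldLocal w).map_source hp.2
  have h1 : ContMDiffAt 𝓘(ℝ, 𝔼 (n + 1)) 𝓘(ℝ, 𝔼 (n + 1)) ∞ (G.foldLocal w).symm (G.fold p) :=
    (G.contDiffAt_foldLocal_symm w hx).contMDiffAt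
  have h2 : (G.foldLocal w).symm (G.fold p) = (G.seamChart w).chart p := by
    rw [G.fold_eq_foldLocal hp, (G.foldLocal w).left_inv hp.2]
  have h3 : ContMDiffAt 𝓘(ℝ, 𝔼 (n + 1)) (𝓡 (n + 1)) ∞ (G.seamChart w).chart.symm
      ((G.foldLocal w).symm (G.fold p)) := by
    rw [h2]
    exact (G.seamChart w).contMDiffAt_symm ((G.seamChart w).map_source hp.1)
  exact h3.comp _ h1

/-! ### Injectivity of the fold-out map near the seam -/

/-- **The fold-out map is injective on a neighbourhood of the seam** on which it is `C^∞`: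
Mathlib's `Set.InjOn.exists_isOpen_superset` (injective on the compact seam, continuous and
locally injective at seam points), intersected with `{retrVec ≠ 0}`. [folklore] -/
theorem exists_injOn_fold : ∃ V : Set P, IsOpen V ∧ G.seam ⊆ V ∧
    V ⊆ {p | G.retrVec p ≠ 0} ∧ InjOn G.fold V := by
  have hinj : InjOn G.fold G.seam := by
    rintro _ ⟨w, rfl⟩ _ ⟨w', rfl⟩ h
    rw [fold_jA_sphereToBall, fold_jA_sphereToBall] at h
    rw [Subtype.ext h]
  obtain ⟨t, ht, hKt, hi⟩ := hinj.exists_isOpen_superset G.isCompact_seam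
    (fun p hp => G.continuousAt_fold (G.retrVec_ne_zero_of_mem_seam hp))
    (fun p hp => by
      obtain ⟨w, rfl⟩ := hp
      exact ⟨G.foldPatch w, (G.isOpen_foldPatch w).mem_nhds (G.jA_mem_foldPatch w),
        G.injOn_fold_foldPatch w⟩)
  exact ⟨t ∩ {p | G.retrVec p ≠ 0}, ht.inter G.isOpen_retrVec_ne_zero,
    subset_inter hKt fun p hp => G.retrVec_ne_zero_of_mem_seam hp, inter_subset_right,
    hi.mono inter_subset_left⟩

/-- The chosen injectivity neighbourhood of the seam. [folklore] -/
def foldInjNbhd : Set P := G.exists_injOn_fold.choose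

/-- It is open. [folklore] -/
theorem isOpen_foldInjNbhd : IsOpen G.foldInjNbhd := G.exists_injOn_fold.choose_spec.1

/-- It contains the seam. [folklore] -/
theorem seam_subset_foldInjNbhd : G.seam ⊆ G.foldInjNbhd := G.exists_injOn_fold.choose_spec.2.1

/-- On it the retraction vector is nonzero. [folklore] -/
theorem foldInjNbhd_subset : G.foldInjNbhd ⊆ {p | G.retrVec p ≠ 0} :=
  G.exists_injOn_fold.choose_spec.2.2.1

/-- On it the fold-out map is injective. [folklore] -/
theorem injOn_fold_foldInjNbhd : InjOn G.fold G.foldInjNbhd := G.exists_injOn_fold.choose_spec.2.2.2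

/-! ### The bicollar: the fold-out map on `foldNbhd` -/

/-- The open neighbourhood of the seam on which everything works: injectivity, local inverses,
`height > -1`, positive partition of unity. [folklore] -/
def foldDomain : Set P :=
  G.foldInjNbhd ∩ (⋃ w : 𝕊 n, G.foldPatch w) ∩ G.pouPos ∩ {p | -1 < G.height p}

/-- `foldDomain` is open. [folklore] -/
theorem isOpen_foldDomain : IsOpen G.foldDomain :=
  ((G.isOpen_foldInjNbhd.inter (isOpen_iUnion fun w => G.isOpen_foldPatch w)).inter
    G.isOpen_pouPos).inter (isOpen_lt continuous_const G.continuous_height)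

/-- The seam lies in `foldDomain`. [folklore] -/
theorem seam_subset_foldDomain : G.seam ⊆ G.foldDomain := by
  intro p hp
  refine ⟨⟨⟨G.seam_subset_foldInjNbhd hp, ?_⟩, G.seam_subset_pouPos hp⟩, ?_⟩
  · obtain ⟨w, rfl⟩ := hp
    exact mem_iUnion.2 ⟨w, G.jA_mem_foldPatch w⟩
  · change -1 < G.height p
    rw [height_eq_zero_of_mem_seam hp]
    norm_num

/-- On `foldDomain`, `‖fold p‖ = 1 + height p`. [folklore] -/
theorem norm_fold_of_mem {p : P} (hp : p ∈ G.foldDomain) : ‖G.fold p‖ = 1 + G.height p := by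
  rw [norm_fold, abs_of_pos]
  have : -1 < G.height p := hp.2
  linarith

/-- The fold-out map is injective on `foldDomain`. [folklore] -/
theorem injOn_fold_foldDomain : InjOn G.fold G.foldDomain :=
  G.injOn_fold_foldInjNbhd.mono fun _ hp => hp.1.1.1

/-- The fold-out map is `C^∞` on `foldDomain`. [folklore] -/
theorem contMDiffOn_fold_foldDomain :
    ContMDiffOn (𝓡 (n + 1)) 𝓘(ℝ, 𝔼 (n + 1)) ∞ G.fold G.foldDomain :=
  G.contMDiffOn_fold.mono fun _ hp => G.foldInjNbhd_subset hp.1.1.1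

/-- The fold-out map is an open map on `foldDomain`. [folklore] -/
theorem isOpen_image_fold_of_subset {U : Set P} (hU : IsOpen U) (hUD : U ⊆ G.foldDomain) :
    IsOpen (G.fold '' U) := by
  have : G.fold '' U = ⋃ w : 𝕊 n, G.fold '' (U ∩ G.foldPatch w) := by
    rw [← image_iUnion, ← inter_iUnion]
    congr 1
    exact (inter_eq_left.2 fun p hp => (hUD hp).1.1.2).symm
  rw [this]
  exact isOpen_iUnion fun w =>
    G.isOpen_image_fold (hU.inter (G.isOpen_foldPatch w)) inter_subset_right

/-- The image of `foldDomain` is an open neighbourhood of the unit sphere. [folklore] -/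
theorem sphere_subset_image_foldDomain : sphere (0 : 𝔼 (n + 1)) 1 ⊆ G.fold '' G.foldDomain := by
  intro x hx
  exact ⟨G.jA (sphereToBall n ⟨x, hx⟩), G.seam_subset_foldDomain (G.jA_sphereToBall_mem_seam _),
    G.fold_jA_sphereToBall ⟨x, hx⟩⟩

/-- **Existence of the width of the bicollar**: some shell `biShell ε`, `0 < ε ≤ 1`, lies in the
image of `foldDomain`. [folklore] -/
theorem exists_foldRadius : ∃ ε : ℝ, 0 < ε ∧ ε ≤ 1 ∧
    (biShell ε : Set (𝔼 (n + 1))) ⊆ G.fold '' G.foldDomain := by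
  obtain ⟨δ, hδ, hsub⟩ := (isCompact_sphere (0 : 𝔼 (n + 1)) 1).exists_thickening_subset_open
    (G.isOpen_image_fold_of_subset G.isOpen_foldDomain Subset.rfl) G.sphere_subset_image_foldDomain
  refine ⟨min δ 1, lt_min hδ one_pos, min_le_right _ _, ?_⟩
  exact ((biShell_subset_thickening (min_le_right _ _)).trans
    (thickening_mono (min_le_left _ _) _)).trans hsub

/-- **The width `ε` of the bicollar.** [folklore] -/
def foldRadius : ℝ := G.exists_foldRadius.choose

/-- `0 < ε`. [folklore] -/
theorem foldRadius_pos : 0 < G.foldRadius := G.exists_foldRadius.choose_spec.1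

/-- `ε ≤ 1`. [folklore] -/
theorem foldRadius_le_one : G.foldRadius ≤ 1 := G.exists_foldRadius.choose_spec.2.1

/-- The shell of width `ε` is covered by `foldDomain`. [folklore] -/
theorem biShell_subset_image : (biShell G.foldRadius : Set (𝔼 (n + 1))) ⊆ G.fold '' G.foldDomain :=
  G.exists_foldRadius.choose_spec.2.2

/-- **The bicollar neighbourhood of the seam**: the part of `foldDomain` over the shell.
[folklore] -/
def foldNbhd : Set P := G.foldDomain ∩ G.fold ⁻¹' biShell G.foldRadius

/-- `foldNbhd` is open. [folklore] -/
theorem isOpen_foldNbhd : IsOpen G.foldNbhd :=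
  G.contMDiffOn_fold_foldDomain.continuousOn.isOpen_inter_preimage G.isOpen_foldDomain
    (isOpen_biShell _)

/-- `foldNbhd ⊆ foldDomain`. [folklore] -/
theorem foldNbhd_subset_foldDomain : G.foldNbhd ⊆ G.foldDomain := inter_subset_left

/-- The seam lies in `foldNbhd`. [folklore] -/
theorem seam_subset_foldNbhd : G.seam ⊆ G.foldNbhd := by
  intro p hp
  refine ⟨G.seam_subset_foldDomain hp, ?_⟩
  obtain ⟨w, rfl⟩ := hp
  rw [mem_preimage, fold_jA_sphereToBall]
  exact mem_biShell_of_norm_eq_one G.foldRadius_pos (by simp)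

/-- The seam points `jA z` lie in `foldNbhd`. [folklore] -/
theorem jA_sphereToBall_mem_foldNbhd (z : 𝕊 n) : G.jA (sphereToBall n z) ∈ G.foldNbhd :=
  G.seam_subset_foldNbhd (G.jA_sphereToBall_mem_seam z)

/-- The fold-out map sends `foldNbhd` into the shell. [folklore] -/
theorem fold_mem_biShell {p : P} (hp : p ∈ G.foldNbhd) :
    G.fold p ∈ (biShell G.foldRadius : Set (𝔼 (n + 1))) :=
  hp.2

/-- `fold` maps `foldNbhd` into the shell. [folklore] -/
theorem mapsTo_fold : MapsTo G.fold G.foldNbhd (biShell G.foldRadius) := fun _ hp => hp.2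

/-- **The fold-out map is injective on `foldNbhd`.** [folklore] -/
theorem injOn_fold : InjOn G.fold G.foldNbhd := G.injOn_fold_foldDomain.mono inter_subset_left

/-- **The fold-out map maps `foldNbhd` onto the shell.** [folklore] -/
theorem surjOn_fold : SurjOn G.fold G.foldNbhd (biShell G.foldRadius) := by
  intro x hx
  obtain ⟨p, hp, rfl⟩ := G.biShell_subset_image hx
  exact ⟨p, ⟨hp, hx⟩, rfl⟩

/-- `fold '' foldNbhd` is the shell. [folklore] -/
theorem image_fold_foldNbhd : G.fold '' G.foldNbhd = biShell G.foldRadius :=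
  (G.mapsTo_fold.image_subset).antisymm G.surjOn_fold

/-- **The fold-out map is `C^∞` on `foldNbhd`.** [folklore] -/
theorem contMDiffOn_fold_foldNbhd : ContMDiffOn (𝓡 (n + 1)) 𝓘(ℝ, 𝔼 (n + 1)) ∞ G.fold G.foldNbhd :=
  G.contMDiffOn_fold_foldDomain.mono inter_subset_left

/-- The fold-out map is `C^∞` at each point of `foldNbhd`. [folklore] -/
theorem contMDiffAt_fold_of_mem {p : P} (hp : p ∈ G.foldNbhd) :
    ContMDiffAt (𝓡 (n + 1)) 𝓘(ℝ, 𝔼 (n + 1)) ∞ G.fold p :=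
  G.contMDiffOn_fold_foldNbhd.contMDiffAt (G.isOpen_foldNbhd.mem_nhds hp)

/-! ### The inverse of the bicollar -/

/-- **The inverse `biShell ε → foldNbhd` of the fold-out map** (junk outside the shell).
[folklore] -/
def foldInv : (𝔼 (n + 1)) → P :=
  haveI : Nonempty P := ⟨G.jA ⟨0, by simp⟩⟩
  Function.invFunOn G.fold G.foldNbhd

/-- `foldInv` maps the shell into `foldNbhd` and is a right inverse of `fold` there. [folklore] -/
theorem foldInv_mem_and_fold_foldInv {x : 𝔼 (n + 1)}
    (hx : x ∈ (biShell G.foldRadius : Set (𝔼 (n + 1)))) :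
    G.foldInv x ∈ G.foldNbhd ∧ G.fold (G.foldInv x) = x := by
  haveI : Nonempty P := ⟨G.jA ⟨0, by simp⟩⟩
  obtain ⟨p, hp, rfl⟩ := G.surjOn_fold hx
  exact Function.invFunOn_pos ⟨p, hp, rfl⟩

/-- `foldInv` maps the shell into `foldNbhd`. [folklore] -/
theorem foldInv_mem {x : 𝔼 (n + 1)} (hx : x ∈ (biShell G.foldRadius : Set (𝔼 (n + 1)))) :
    G.foldInv x ∈ G.foldNbhd :=
  (G.foldInv_mem_and_fold_foldInv hx).1

/-- `fold ∘ foldInv = id` on the shell. [folklore] -/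
@[simp] theorem fold_foldInv {x : 𝔼 (n + 1)} (hx : x ∈ (biShell G.foldRadius : Set (𝔼 (n + 1)))) :
    G.fold (G.foldInv x) = x :=
  (G.foldInv_mem_and_fold_foldInv hx).2

/-- `foldInv ∘ fold = id` on `foldNbhd`. [folklore] -/
@[simp] theorem foldInv_fold {p : P} (hp : p ∈ G.foldNbhd) : G.foldInv (G.fold p) = p :=
  G.injOn_fold (G.foldInv_mem (G.fold_mem_biShell hp)) hp (G.fold_foldInv (G.fold_mem_biShell hp))

/-- `foldInv` maps the shell into `foldNbhd`. [folklore] -/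
theorem mapsTo_foldInv : MapsTo G.foldInv (biShell G.foldRadius) G.foldNbhd := fun _ hx =>
  G.foldInv_mem hx

/-- `foldInv` of a unit vector is the seam point. [folklore] -/
@[simp] theorem foldInv_coe_sphere (z : 𝕊 n) :
    G.foldInv (z : 𝔼 (n + 1)) = G.jA (sphereToBall n z) := by
  rw [← G.fold_jA_sphereToBall z, G.foldInv_fold (G.jA_sphereToBall_mem_foldNbhd z)]

/-- **The inverse of the bicollar is `C^∞` on the shell.** Near `x = fold p`, `p ∈ foldPatch w`,
it agrees with the local inverse `foldInvLoc w`. [folklore] -/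
theorem contMDiffOn_foldInv :
    ContMDiffOn 𝓘(ℝ, 𝔼 (n + 1)) (𝓡 (n + 1)) ∞ G.foldInv (biShell G.foldRadius) := by
  intro x hx
  obtain ⟨p, hp, rfl⟩ := G.surjOn_fold hx
  obtain ⟨w, hw⟩ := mem_iUnion.1 hp.1.1.1.2
  -- near `fold p`, `foldInv = foldInvLoc w`
  have hU : IsOpen (G.fold '' (G.foldNbhd ∩ G.foldPatch w)) :=
    G.isOpen_image_fold (G.isOpen_foldNbhd.inter (G.isOpen_foldPatch w)) inter_subset_right
  have hev : G.foldInv =ᶠ[𝓝 (G.fold p)] G.foldInvLoc w := by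
    filter_upwards [hU.mem_nhds ⟨p, ⟨hp, hw⟩, rfl⟩]
    rintro _ ⟨q, ⟨hq, hqw⟩, rfl⟩
    rw [G.foldInv_fold hq, G.foldInvLoc_fold hqw]
  exact ((G.contMDiffAt_foldInvLoc hw).congr_of_eventuallyEq hev).contMDiffWithinAt

/-- The inverse of the bicollar is `C^∞` at each point of the shell. [folklore] -/
theorem contMDiffAt_foldInv {x : 𝔼 (n + 1)} (hx : x ∈ (biShell G.foldRadius : Set (𝔼 (n + 1)))) :
    ContMDiffAt 𝓘(ℝ, 𝔼 (n + 1)) (𝓡 (n + 1)) ∞ G.foldInv x :=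
  G.contMDiffOn_foldInv.contMDiffAt ((isOpen_biShell _).mem_nhds hx)

/-- The inverse of the bicollar is continuous on the shell. [folklore] -/
theorem continuousOn_foldInv : ContinuousOn G.foldInv (biShell G.foldRadius) :=
  G.contMDiffOn_foldInv.continuousOn

/-! ### Which disc, read off the norm of the fold-out map -/

/-- **Inside the unit sphere is the interior of the first disc.** [folklore] -/
theorem norm_fold_lt_one_iff {p : P} (hp : p ∈ G.foldNbhd) :
    ‖G.fold p‖ < 1 ↔ ∃ a : 𝔻 (n + 1), ‖(a : 𝔼 (n + 1))‖ < 1 ∧ G.jA a = p := by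
  rw [G.norm_fold_of_mem hp.1]
  constructor
  · intro h
    exact exists_jA_of_height_neg (by linarith)
  · rintro ⟨a, ha, hap⟩
    have := height_neg ha hap hp.1.1.2
    linarith

/-- **Outside the unit sphere is the interior of the second disc.** [folklore] -/
theorem one_lt_norm_fold_iff {p : P} (hp : p ∈ G.foldNbhd) :
    1 < ‖G.fold p‖ ↔ ∃ b : 𝔻 (n + 1), ‖(b : 𝔼 (n + 1))‖ < 1 ∧ G.jB b = p := by
  rw [G.norm_fold_of_mem hp.1]
  constructor
  · intro h
    exact exists_jB_of_height_pos (by linarith)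
  · rintro ⟨b, hb, hbp⟩
    have := height_pos hb hbp hp.1.1.2
    linarith

/-- **The unit sphere is the seam.** [folklore] -/
theorem norm_fold_eq_one_iff {p : P} (hp : p ∈ G.foldNbhd) : ‖G.fold p‖ = 1 ↔ p ∈ G.seam := by
  rw [G.norm_fold_of_mem hp.1]
  constructor
  · intro h
    exact mem_seam_of_height_eq_zero (by linarith) hp.1.1.2
  · intro h
    rw [height_eq_zero_of_mem_seam h, add_zero]

/-- **The closed unit ball is the first disc.** [folklore] -/
theorem norm_fold_le_one_iff {p : P} (hp : p ∈ G.foldNbhd) : ‖G.fold p‖ ≤ 1 ↔ p ∈ range G.jA := by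
  constructor
  · intro h
    rcases h.lt_or_eq with h | h
    · obtain ⟨a, -, rfl⟩ := (G.norm_fold_lt_one_iff hp).1 h
      exact ⟨a, rfl⟩
    · exact G.seam_subset_range_jA ((G.norm_fold_eq_one_iff hp).1 h)
  · rintro ⟨a, rfl⟩
    by_cases ha : ‖(a : 𝔼 (n + 1))‖ < 1
    · exact ((G.norm_fold_lt_one_iff hp).2 ⟨a, ha, rfl⟩).le
    · obtain ⟨w, hw⟩ :=
        exists_sphereToBall_eq ((mem_closedBall_zero_iff.1 a.2).antisymm (not_lt.1 ha))
      rw [← hw, fold_jA_sphereToBall]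
      simp

/-- **The exterior of the open unit ball is the second disc.** [folklore] -/
theorem one_le_norm_fold_iff {p : P} (hp : p ∈ G.foldNbhd) : 1 ≤ ‖G.fold p‖ ↔ p ∈ range G.jB := by
  constructor
  · intro h
    rcases h.lt_or_eq with h | h
    · obtain ⟨b, -, rfl⟩ := (G.one_lt_norm_fold_iff hp).1 h
      exact ⟨b, rfl⟩
    · exact G.seam_subset_range_jB ((G.norm_fold_eq_one_iff hp).1 h.symm)
  · rintro ⟨b, rfl⟩
    by_cases hb : ‖(b : 𝔼 (n + 1))‖ < 1
    · exact ((G.one_lt_norm_fold_iff hp).2 ⟨b, hb, rfl⟩).le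
    · obtain ⟨w, hw⟩ :=
        exists_sphereToBall_eq ((mem_closedBall_zero_iff.1 b.2).antisymm (not_lt.1 hb))
      rw [← hw, G.jB_sphereToBall, fold_jA_sphereToBall]
      simp

/-- Points of the shell inside the closed unit ball come from the first disc. [folklore] -/
theorem foldInv_mem_range_jA {x : 𝔼 (n + 1)} (hx : x ∈ (biShell G.foldRadius : Set (𝔼 (n + 1))))
    (h1 : ‖x‖ ≤ 1) : G.foldInv x ∈ range G.jA :=
  (G.norm_fold_le_one_iff (G.foldInv_mem hx)).1 (by rwa [G.fold_foldInv hx])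

/-- Points of the shell outside the open unit ball come from the second disc. [folklore] -/
theorem foldInv_mem_range_jB {x : 𝔼 (n + 1)} (hx : x ∈ (biShell G.foldRadius : Set (𝔼 (n + 1))))
    (h1 : 1 ≤ ‖x‖) : G.foldInv x ∈ range G.jB :=
  (G.one_le_norm_fold_iff (G.foldInv_mem hx)).1 (by rwa [G.fold_foldInv hx])

/-- Points of the shell in the open unit ball come from the interior of the first disc.
[folklore] -/
theorem norm_invA_foldInv_lt_one {x : 𝔼 (n + 1)} (hx : x ∈ (biShell G.foldRadius : Set (𝔼 (n + 1))))
    (h1 : ‖x‖ < 1) : ‖(G.invA (G.foldInv x) : 𝔼 (n + 1))‖ < 1 := by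
  obtain ⟨a, ha, hap⟩ := (G.norm_fold_lt_one_iff (G.foldInv_mem hx)).1 (by rwa [G.fold_foldInv hx])
  rw [← hap, G.invA_jA]
  exact ha

/-- Points of the shell outside the closed unit ball come from the interior of the second disc.
[folklore] -/
theorem norm_invB_foldInv_lt_one {x : 𝔼 (n + 1)} (hx : x ∈ (biShell G.foldRadius : Set (𝔼 (n + 1))))
    (h1 : 1 < ‖x‖) : ‖(G.invB (G.foldInv x) : 𝔼 (n + 1))‖ < 1 := by
  obtain ⟨b, hb, hbp⟩ := (G.one_lt_norm_fold_iff (G.foldInv_mem hx)).1 (by rwa [G.fold_foldInv hx])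
  rw [← hbp, G.invB_jB]
  exact hb

end BallGluingData

end FoldOut

end Literature.Topology.FourManifolds
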